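import Literature.AnabelianGeometry.SemiGraphs.PSCSeparatingCoveringsTwoComponentAffineEdges
import Literature.AnabelianGeometry.SemiGraphs.ProSigmaHeisenbergSeparation
import Literature.AnabelianGeometry.SemiGraphs.PSCTwoComponentUnmarkedEdges
import HarnessLib

/-!
# [CombGC] Prop. 1.2, proof p. 9: EDGE-LIKE separating coverings at two-component data POINTED ON BOTH SIDES (row F-2827)

Mochizuki, *A combinatorial version of the Grothendieck conjecture*, Tohoku Math. J. **59** (2007)
[CombGC], PROOF of Proposition 1.2, author's manuscript p. 9, the resp'd (edge) case: "respectively,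
`e₁ ≠ e₂` … there exists a finite étale … `Π_G`-covering `G' → G` whose restriction to the anabelioid
`G_{e₂}` is trivial …, but whose restriction to the anabelioid `G_{e₁}` is nontrivial"
[cite: MochizukiCombGC2007, Prop 1.2 proof p.9]; typed LEVEL-WISE as `PSCDatum.EdgeLikeSeparatingCoverings`
(abc-iut-w4-d081, row P12-L01-E; abc-iut FACT-LIST row F-2827, the edge conjunct of F-2829 / F-2830 — a
schema whose universal closure is refuted as typed; the instance forms at genuine carriers are the content).

PROOF-ONLY file (abc-iut-f-166 gen 6, row «ONE-CUSP-CORNERS» (1), file 2/3; 0 definitions).  The carrier: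
the data of two-component shape POINTED ON BOTH SIDES of gen 2 (`C₀ ∪_ν C₁`, `1 ≤ s ≤ r − 1` marked
points on `C₁`, both components stable; node group `cl ι⟨ε⟩`, cusp groups the closed cusp inertia groups;
`ι : Γ_{g,r} → Π` a profinite pro-`Σ` completion) — in particular a component with a SINGLE marked point
`c_k`, where `ε ≡ c_k^{∓1}` modulo commutators, so that every ABELIAN character killing one of `ε`, `c_k`
kills the other: the corner the cusp characters `δ_k − δ_m` of the affine file
(`edgeLikeSeparatingCoverings_of_twoComponentAffine`, `s ≥ 2`, `r − s ≥ 2`) cannot reach.  The node loop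
and every cusp generator are members of free bases (`exists_freeGroupBasis_nodeLoop`,
`exists_freeGroupBasis_eq_c`), so the gen-3 engine `edgeLikeSeparatingCoverings_of_rankOneFreeFactors`
applies; the separating homomorphisms take values in `ℤ/3 × H₃` (`H₃` the Heisenberg group mod `3`,
`Heisenberg.exists_heisenbergTriple_central`): cusp characters `δ_k − δ_m` (abc-iut-f-164's
`exists_handleCuspCharacter`) where a spare marked point is available, and the NON-ABELIAN handle-cusp
homomorphisms `(a_{i₀}, b_{i₀}, c_{j₀}) ↦ (X, Y, [X,Y]⁻¹)` (`exists_hom_handle_cusp`,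
`hom_handle_cusp_nodeLoop`) at a component with a single marked point, the handle taken on the component
that stability then makes of positive genus (both components of genus `0` = the affine shape, in the tree).

* `edgeLikeSeparatingCoverings_of_twoComponentPointed` — **F-2827** (`V' := V`) at EVERY such datum:
  node/cusp, cusp/node and cusp/cusp pairs of level edges alike.

Instance forms at data of the shape of genuine two-component curves: consistency evidence for the typed
schema, not the printed theorem for all pointed stable curves.  Nothing here takes a side on
[IUTchIII] Cor. 3.12.
-/

noncomputable section

namespace Literature.AnabelianGeometry.SemiGraphs

namespace PSCDatum

open scoped Pointwise
open Multiplicative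
open Literature.GroupTheory.CombinatorialGroupTheory
open Literature.GroupTheory.CombinatorialGroupTheory.PuncturedSurfaceGroup (a b c cuspInertia
  exists_freeGroupBasis_nodeLoop exists_freeGroupBasis_eq_c exists_handleCuspCharacter
  exists_hom_handle_cusp hom_handle_cusp_nodeLoop)
open SemiGraphOfAnabelioids (IsProSigmaCompletion)
open TwoComponentAffine (character_nodeLoop sum_ite_twoDelta sum_twoDelta)

section Datum

variable {P : Type} [Group P] [TopologicalSpace P] [IsTopologicalGroup P]
variable [CompactSpace P] [TotallyDisconnectedSpace P] {Sigma : Set ℕ} {g r : ℕ}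

/-! ### F-2827: the edge-like separating coverings -/

/-- `ofAdd 1 ≠ 1` in `ℤ/3`. [cite: MochizukiCombGC2007, Prop 1.2 proof p.9] -/
private theorem ofAdd_one_ne_one₃ : (ofAdd (1 : ZMod 3) : Multiplicative (ZMod 3)) ≠ 1 := by
  intro h
  have h1 : (1 : ZMod 3) = 0 := Multiplicative.ofAdd.injective (h.trans ofAdd_zero.symm)
  exact absurd h1 (by decide)

/-- **Row P12-L01-E / F-2827 (`EdgeLikeSeparatingCoverings`, `V' := V`) at EVERY two-component datum
pointed on both sides** (`1 ≤ s ≤ r − 1`, both components stable; node group `cl ι⟨ε⟩`, cusp groups the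
closed cusp inertia groups).  The node loop and every cusp generator are members of free bases
(`exists_freeGroupBasis_nodeLoop`, `exists_freeGroupBasis_eq_c`), so
`edgeLikeSeparatingCoverings_of_rankOneFreeFactors` applies; separating homomorphisms into
`ℤ/3 × H₃` (`H₃` the Heisenberg group mod `3`): cusp characters `δ_k − δ_m` where two marked points are
available, handle-cusp homomorphisms `(a_{i₀}, b_{i₀}, c_{j₀}) ↦ (X, Y, [X,Y]⁻¹)` where a component
carries a single marked point (both components of genus `0` = the affine shape, already in the tree).
[cite: MochizukiCombGC2007, Prop 1.2 proof p.9] -/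
theorem edgeLikeSeparatingCoverings_of_twoComponentPointed (hne : Sigma.Nonempty)
    (hprime : ∀ p ∈ Sigma, p.Prime) (ι : PuncturedSurfaceGroup g r →* P)
    (hι : IsProSigmaCompletion Sigma ι) (G : PSCDatum P) {g₀ s : ℕ} (hg₀ : g₀ ≤ g) (hs : 1 ≤ s)
    (hsr : s + 1 ≤ r) (hst₀ : 1 ≤ g₀ ∨ 2 ≤ r - s) (hst₁ : 1 ≤ g - g₀ ∨ 2 ≤ s) (e : G.graph.C ≃ Fin r)
    (hC : ∀ c', G.cuspGp c' = ((cuspInertia (g := g) (e c')).map ι).topologicalClosure)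
    (ε : PuncturedSurfaceGroup g r)
    (hε : ε = ((List.finRange r).map fun j : Fin r =>
          if s ≤ (j : ℕ) then PuncturedSurfaceGroup.c (g := g) j else 1).prod *
        ((List.finRange g).map fun i : Fin g => if (i : ℕ) < g₀ then
          PuncturedSurfaceGroup.a (r := r) i * PuncturedSurfaceGroup.b i *
            (PuncturedSurfaceGroup.a i)⁻¹ * (PuncturedSurfaceGroup.b i)⁻¹ else 1).prod)
    (n₀ : G.graph.N) (hN : ∀ n, n = n₀)
    (hE : G.nodeGp n₀ = ((Subgroup.zpowers ε).map ι).topologicalClosure) :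
    G.EdgeLikeSeparatingCoverings := by
  classical
  -- both components of genus `0`: the affine shape, already in the tree
  by_cases hg : g = 0
  · subst hg
    have hs2 : 2 ≤ s := by rcases hst₁ with h | h <;> omega
    have hsr2 : s + 2 ≤ r := by rcases hst₀ with h | h <;> omega
    exact G.edgeLikeSeparatingCoverings_of_twoComponentAffine hne hprime ι hι hs2 hsr2 e hC n₀ hN ε hε hE
  have hg1 : 0 < g := Nat.pos_of_ne_zero hg
  obtain ⟨r', rfl⟩ : ∃ r', r = r' + 1 := ⟨r - 1, by omega⟩
  have hSig : ∃ ℓ ∈ Sigma, ℓ.Prime := by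
    obtain ⟨ℓ, hℓ⟩ := hne
    exact ⟨ℓ, hℓ, hprime ℓ hℓ⟩
  -- the generators of the edge groups
  let xs : G.graph.N ⊕ G.graph.C → PuncturedSurfaceGroup g (r' + 1) :=
    Sum.elim (fun _ => ε) fun c' => c (e c')
  have hx : ∀ e', G.edgeGp e' = ((Subgroup.zpowers (xs e')).map ι).topologicalClosure := by
    rintro (n | c')
    · change G.nodeGp n = ((Subgroup.zpowers ε).map ι).topologicalClosure
      rw [hN n, hE]
    · exact hC c'
  -- every generator is a member of a free basis
  have hfac : ∀ e', ∃ (κ : Type) (bκ : FreeGroupBasis κ (PuncturedSurfaceGroup g (r' + 1))) (k : κ),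
      bκ k = xs e' := by
    rintro (n | c')
    · obtain ⟨b₁, -, -, -, hk₁⟩ := exists_freeGroupBasis_nodeLoop g r' g₀ s (by omega) (by omega) ε hε
      exact ⟨_, b₁, _, hk₁⟩
    · obtain ⟨β, bs, k, hk⟩ := exists_freeGroupBasis_eq_c (g := g) (by omega : 2 ≤ r' + 1) (e c')
      exact ⟨β, bs, k, hk⟩
  -- the target `ℤ/3 × H₃`
  obtain ⟨φ, X, Y, Z, hXYZ, -, hZpow, -⟩ := Heisenberg.exists_heisenbergTriple_central 3
  have hZ1 : Z ≠ 1 := fun h => by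
    have h3 : 3 ∣ 1 := (hZpow 1).mp (by rw [pow_one, h])
    omega
  have hW : X * Y * X⁻¹ * Y⁻¹ * Z⁻¹ = 1 := by rw [hXYZ, mul_inv_cancel]
  -- abbreviations for the two factors of the target
  have hinl : ∀ (χ : PuncturedSurfaceGroup g (r' + 1) →* Multiplicative (ZMod 3))
      (x : PuncturedSurfaceGroup g (r' + 1)),
      ((MonoidHom.inl (Multiplicative (ZMod 3))
        (Multiplicative (ZMod 3 × ZMod 3) ⋊[φ] Multiplicative (ZMod 3))).comp χ) x = 1 ↔ χ x = 1 :=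
    fun χ x => by
      simp only [MonoidHom.comp_apply, MonoidHom.inl_apply, Prod.mk_eq_one, and_true]
  have hinr : ∀ (ψ : PuncturedSurfaceGroup g (r' + 1) →*
      Multiplicative (ZMod 3 × ZMod 3) ⋊[φ] Multiplicative (ZMod 3)) (x : PuncturedSurfaceGroup g (r' + 1)),
      ((MonoidHom.inr (Multiplicative (ZMod 3))
        (Multiplicative (ZMod 3 × ZMod 3) ⋊[φ] Multiplicative (ZMod 3))).comp ψ) x = 1 ↔ ψ x = 1 :=
    fun ψ x => by
      simp only [MonoidHom.comp_apply, MonoidHom.inr_apply, Prod.mk_eq_one, true_and]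
  -- the abelian certificates `δ_k − δ_m`
  have habel : ∀ k m : Fin (r' + 1), k ≠ m →
      ∃ χ : PuncturedSurfaceGroup g (r' + 1) →* Multiplicative (ZMod 3),
        χ (c k) ≠ 1 ∧ (∀ j, j ≠ k → j ≠ m → χ (c j) = 1) ∧
          χ ε = ofAdd ((if s ≤ (k : ℕ) then (1 : ZMod 3) else 0) +
            (if s ≤ (m : ℕ) then (-1 : ZMod 3) else 0)) := by
    intro k m hkm
    obtain ⟨χ, -, -, hχc⟩ := exists_handleCuspCharacter (g := g) (r := r' + 1) (n := 3) (fun _ => 0)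
      (fun _ => 0) (fun j => (if j = k then (1 : ZMod 3) else 0) + (if j = m then (-1 : ZMod 3) else 0))
      (sum_twoDelta k m)
    refine ⟨χ, ?_, fun j hjk hjm => ?_, ?_⟩
    · rw [hχc, if_pos rfl, if_neg hkm, add_zero]
      exact ofAdd_one_ne_one₃
    · rw [hχc, if_neg hjk, if_neg hjm, add_zero, ofAdd_zero]
    · rw [hε, character_nodeLoop χ hχc g₀ s, sum_ite_twoDelta]
  -- the separating homomorphisms
  have hsep : ∀ e₁ e₂, e₁ ≠ e₂ → ∃ χ : PuncturedSurfaceGroup g (r' + 1) →*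
      Multiplicative (ZMod 3) × (Multiplicative (ZMod 3 × ZMod 3) ⋊[φ] Multiplicative (ZMod 3)),
      χ (xs e₂) = 1 ∧ χ (xs e₁) ≠ 1 := by
    rintro (n₁ | c₁) (n₂ | c₂) hne12
    · -- node / node: there is only one node
      exact absurd (by rw [hN n₁, hN n₂]) hne12
    · -- alive: the node `ε`; killed: the cusp `k = e c₂`
      change ∃ χ : PuncturedSurfaceGroup g (r' + 1) →*
        Multiplicative (ZMod 3) × (Multiplicative (ZMod 3 × ZMod 3) ⋊[φ] Multiplicative (ZMod 3)),
        χ (c (e c₂)) = 1 ∧ χ ε ≠ 1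
      by_cases hAB : (∃ j₁ : Fin (r' + 1), s ≤ (j₁ : ℕ) ∧ j₁ ≠ e c₂) ∧
          (∃ j₂ : Fin (r' + 1), (j₂ : ℕ) < s ∧ j₂ ≠ e c₂)
      · -- a spare marked point on each side: the character `δ_{j₁} − δ_{j₂}`
        obtain ⟨⟨j₁, hj₁s, hj₁k⟩, ⟨j₂, hj₂s, hj₂k⟩⟩ := hAB
        have h12 : j₁ ≠ j₂ := fun h => by rw [h] at hj₁s; omega
        obtain ⟨χ, -, hχ0, hχε⟩ := habel j₁ j₂ h12
        refine ⟨(MonoidHom.inl _ _).comp χ, (hinl χ _).mpr (hχ0 (e c₂) hj₁k.symm hj₂k.symm), ?_⟩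
        rw [Ne, hinl, hχε, if_pos hj₁s, if_neg (by omega), add_zero]
        exact ofAdd_one_ne_one₃
      · rw [not_and_or] at hAB
        rcases hAB with hA | hB
        · -- `e c₂` is the only marked point of `C₀`: handle on `C₀` (positive genus), cusp on `C₁`
          have hg₀1 : 1 ≤ g₀ := by
            rcases hst₀ with h | h
            · exact h
            · exfalso
              apply hA
              by_cases hk1 : e c₂ = ⟨s, by omega⟩
              · exact ⟨⟨s + 1, by omega⟩, by simp only; omega, fun h' => by
                  rw [hk1] at h'; exact absurd (congrArg Fin.val h') (by simp)⟩
              · exact ⟨⟨s, by omega⟩, le_rfl, fun h' => hk1 h'.symm⟩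
          have hks : s ≤ (e c₂ : ℕ) := by
            by_contra hlt
            exact hA ⟨⟨s, by omega⟩, le_rfl, fun h' => by rw [← h'] at hlt; exact hlt le_rfl⟩
          obtain ⟨ψ, ha, hb, hc, hab, hc'⟩ :=
            exists_hom_handle_cusp (g := g) (r := r' + 1) ⟨0, by omega⟩ ⟨0, by omega⟩ X Y Z⁻¹ hW
          refine ⟨(MonoidHom.inr _ _).comp ψ, (hinr ψ _).mpr (hc' (e c₂) fun h' => ?_), ?_⟩
          · rw [h'] at hks
            simp only at hks
            omega
          · rw [Ne, hinr, hε, hom_handle_cusp_nodeLoop ψ ha hb hc hab hc' g₀ s,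
              if_neg (by simp only; omega), if_pos (by simp only; omega), one_mul, hXYZ]
            exact hZ1
        · -- `e c₂` is the only marked point of `C₁` (`s = 1`): handle on `C₁`, cusp on `C₀`
          have hg₁1 : g₀ < g := by
            rcases hst₁ with h | h
            · omega
            · exfalso
              apply hB
              by_cases hk0 : e c₂ = ⟨0, by omega⟩
              · exact ⟨⟨1, by omega⟩, by simp only; omega, fun h' => by
                  rw [hk0] at h'; exact absurd (congrArg Fin.val h') (by simp)⟩
              · exact ⟨⟨0, by omega⟩, by simp only; omega, fun h' => hk0 h'.symm⟩
          have hks : (e c₂ : ℕ) < s := by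
            by_contra hge
            exact hB ⟨⟨0, by omega⟩, by simp only; omega, fun h' => by
              rw [← h'] at hge; simp only at hge; omega⟩
          obtain ⟨ψ, ha, hb, hc, hab, hc'⟩ :=
            exists_hom_handle_cusp (g := g) (r := r' + 1) ⟨g₀, hg₁1⟩ ⟨s, by omega⟩ X Y Z⁻¹ hW
          refine ⟨(MonoidHom.inr _ _).comp ψ, (hinr ψ _).mpr (hc' (e c₂) fun h' => ?_), ?_⟩
          · rw [h'] at hks
            simp only at hks
            omega
          · rw [Ne, hinr, hε, hom_handle_cusp_nodeLoop ψ ha hb hc hab hc' g₀ s,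
              if_pos (show s ≤ ((⟨s, _⟩ : Fin (r' + 1)) : ℕ) from le_rfl),
              if_neg (show ¬ ((⟨g₀, hg₁1⟩ : Fin g) : ℕ) < g₀ from lt_irrefl _), mul_one]
            exact inv_ne_one.mpr hZ1
    · -- alive: the cusp `k = e c₁`; killed: the node
      change ∃ χ : PuncturedSurfaceGroup g (r' + 1) →*
        Multiplicative (ZMod 3) × (Multiplicative (ZMod 3 × ZMod 3) ⋊[φ] Multiplicative (ZMod 3)),
        χ ε = 1 ∧ χ (c (e c₁)) ≠ 1
      by_cases hD : ∃ m : Fin (r' + 1), m ≠ e c₁ ∧ (s ≤ (m : ℕ) ↔ s ≤ (e c₁ : ℕ))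
      · -- a second marked point on the same component: the character `δ_k − δ_m`
        obtain ⟨m, hmk, hside⟩ := hD
        obtain ⟨χ, hχk, -, hχε⟩ := habel (e c₁) m hmk.symm
        refine ⟨(MonoidHom.inl _ _).comp χ, (hinl χ _).mpr ?_, fun h => hχk ((hinl χ _).mp h)⟩
        rw [hχε]
        by_cases hks : s ≤ (e c₁ : ℕ)
        · rw [if_pos hks, if_pos (hside.mpr hks), add_neg_cancel, ofAdd_zero]
        · rw [if_neg hks, if_neg (fun h => hks (hside.mp h)), add_zero, ofAdd_zero]
      · -- `e c₁` is the only marked point of its component, which then has positive genus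
        by_cases hks : s ≤ (e c₁ : ℕ)
        · have hg₀1 : 1 ≤ g₀ := by
            rcases hst₀ with h | h
            · exact h
            · exfalso
              apply hD
              by_cases hk1 : e c₁ = ⟨s, by omega⟩
              · refine ⟨⟨s + 1, by omega⟩, fun h' => ?_, ⟨fun _ => hks, fun _ => by simp only; omega⟩⟩
                rw [hk1] at h'
                exact absurd (congrArg Fin.val h') (by simp)
              · exact ⟨⟨s, by omega⟩, fun h' => hk1 h'.symm, ⟨fun _ => hks, fun _ => le_rfl⟩⟩
          obtain ⟨ψ, ha, hb, hc, hab, hc'⟩ :=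
            exists_hom_handle_cusp (g := g) (r := r' + 1) ⟨0, by omega⟩ (e c₁) X Y Z⁻¹ hW
          refine ⟨(MonoidHom.inr _ _).comp ψ, (hinr ψ _).mpr ?_, fun h => ?_⟩
          · rw [hε, hom_handle_cusp_nodeLoop ψ ha hb hc hab hc' g₀ s, if_pos hks,
              if_pos (show ((⟨0, _⟩ : Fin g) : ℕ) < g₀ by simp only; omega), hXYZ, inv_mul_cancel]
          · have h' := (hinr ψ _).mp h
            rw [hc] at h'
            exact hZ1 (inv_eq_one.mp h')
        · have hg₁1 : g₀ < g := by
            rcases hst₁ with h | h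
            · omega
            · exfalso
              apply hD
              by_cases hk0 : e c₁ = ⟨0, by omega⟩
              · refine ⟨⟨1, by omega⟩, fun h' => ?_, ⟨fun h' => ?_, fun h' => absurd h' hks⟩⟩
                · rw [hk0] at h'
                  exact absurd (congrArg Fin.val h') (by simp)
                · simp only at h'
                  omega
              · refine ⟨⟨0, by omega⟩, fun h' => hk0 h'.symm, ⟨fun h' => ?_, fun h' => absurd h' hks⟩⟩
                simp only at h'
                omega
          obtain ⟨ψ, ha, hb, hc, hab, hc'⟩ :=
            exists_hom_handle_cusp (g := g) (r := r' + 1) ⟨g₀, hg₁1⟩ (e c₁) X Y Z⁻¹ hW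
          refine ⟨(MonoidHom.inr _ _).comp ψ, (hinr ψ _).mpr ?_, fun h => ?_⟩
          · rw [hε, hom_handle_cusp_nodeLoop ψ ha hb hc hab hc' g₀ s, if_neg hks,
              if_neg (show ¬ ((⟨g₀, hg₁1⟩ : Fin g) : ℕ) < g₀ from lt_irrefl _), mul_one]
          · have h' := (hinr ψ _).mp h
            rw [hc] at h'
            exact hZ1 (inv_eq_one.mp h')
    · -- cusp / cusp, `e c₁ ≠ e c₂`: the handle-cusp homomorphism at the cusp `e c₁`
      have hkm : e c₁ ≠ e c₂ := fun h => hne12 (by rw [e.injective h])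
      change ∃ χ : PuncturedSurfaceGroup g (r' + 1) →*
        Multiplicative (ZMod 3) × (Multiplicative (ZMod 3 × ZMod 3) ⋊[φ] Multiplicative (ZMod 3)),
        χ (c (e c₂)) = 1 ∧ χ (c (e c₁)) ≠ 1
      obtain ⟨ψ, -, -, hc, -, hc'⟩ :=
        exists_hom_handle_cusp (g := g) (r := r' + 1) ⟨0, hg1⟩ (e c₁) X Y Z⁻¹ hW
      refine ⟨(MonoidHom.inr _ _).comp ψ, (hinr ψ _).mpr (hc' (e c₂) hkm.symm), fun h => ?_⟩
      have h' := (hinr ψ _).mp h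
      rw [hc] at h'
      exact hZ1 (inv_eq_one.mp h')
  exact G.edgeLikeSeparatingCoverings_of_rankOneFreeFactors hι hSig xs hx hfac hsep

end Datum

end PSCDatum

end Literature.AnabelianGeometry.SemiGraphs

end
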